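import Summits.Ventures.LatticeQCDFlow.Scoring.GaussianMovingAverage
import Summits.Ventures.LatticeQCDFlow.Scoring.MadrasSokalDataWindowCLT

/-!
# NOTHING LEFT TO ASSUME, AT THE SCORER'S OWN WINDOW: the `τ_int` CLT for Gaussian moving-average data read at scorer B's data-chosen Madras–Sokal window

HONEST FRAMING: exact (Metropolis-corrected) sampling algorithms for lattice gauge theory;
figures of merit are autocorrelation/cost numbers at stated couplings and volumes; no
continuum-physics claim.

Venture `LatticeQCDFlow` (cell pub-lqcd), sub-topic `Scoring`; FANOUT row 16 (`su2-base`), GEN-8.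
NEW WORK of the cell — the capstone of the data-chosen-window line: GEN-7's
`GaussianMovingAverage.gaussianMA_tauIntWindow_clt` (every hypothesis of the fixed-window CLT discharged
for `X_i = Σ_j a_j ξ_{i+j}`, `ξ` i.i.d. `N(0,1)`, `a ≠ 0`) × GEN-8's `MadrasSokalDataWindow` /
`MadrasSokalDataWindowCLT` (transfer to the data-chosen window; Z-free per-window consistency) /
`MadrasSokalWindowSelector` (scorer B's `ms_window`).  No definition; nothing cited as a fact.

* `integral_lagProd_maMap`, `popCurve_maMap` — for MA data the population curve of the scorer,
  `W ↦ tauIntWindow (E[X_0X_·]/E[X_0²]) W`, IS `W ↦ tauIntWindow (maRho a) W`.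
* **`gaussianMA_tauIntWindow_clt_at_msWindowSel`** — `ξ` i.i.d. standard normal, `a ≠ 0`, scorer
  constant `c > 0`, and the MA autocorrelation curve `W ↦ tauIntWindow (maRho a) W` crossing the line
  `W = c τ_W` STRICTLY at `w ≤ Wmax` (a property of `(a, c)` alone, decidable by finitely many
  inequalities).  Then with `Ŵ_N = msWindowSel c Wmax (τ̂_N(·))` computed from the same data,
  `√N (τ̂_N(Ŵ_N) − tauIntWindow (maRho a) Ŵ_N) ⇒ ⟪ℓ, Z⟫` on `(ℝ^{w+1}, N(0, Σ_{m+w}))`, and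
  `⟪ℓ, Z⟫ ~ N(0, tauHatRatioAVar (maRho a) w)` — GEN-6's `R(w)`.  No hypothesis on the data remains.

NOT CLAIMED: tangential `(a, c)`; numbers.
-/

noncomputable section

open MeasureTheory ProbabilityTheory Filter Finset WithLp
open scoped Topology ENNReal RealInnerProductSpace

namespace Summit.Ventures.LatticeQCDFlow.Scoring

section GaussianMA

variable {Ω : Type*} [MeasurableSpace Ω] {P : Measure Ω} [IsProbabilityMeasure P]
variable {ξ : ℕ → Ω → ℝ} {m : ℕ}

/-- For Gaussian MA data `E[X_0 X_t] = γ(0) ρ(t)` with `ρ = maRho a`. -/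
theorem integral_lagProd_maMap (hξ : ∀ i, Measurable (ξ i)) (hind : iIndepFun ξ P)
    (hlaw : ∀ i, HasLaw (ξ i) (gaussianReal 0 1) P) {a : Fin (m + 1) → ℝ} (ha : a ≠ 0) (t : ℕ) :
    P[fun ω => blockFactor (maMap a) ξ 0 ω * blockFactor (maMap a) ξ t ω] = maACF a 0 * maRho a t :=
  integral_lagProd_eq_of_wick (isWickFamily_maMap hξ hind hlaw a) (fun i j => maCov_eq_evenExt ha i j) t

/-- **The scorer's population curve for MA data is `W ↦ tauIntWindow (maRho a) W`.** -/
theorem popCurve_maMap (hξ : ∀ i, Measurable (ξ i)) (hind : iIndepFun ξ P)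
    (hlaw : ∀ i, HasLaw (ξ i) (gaussianReal 0 1) P) {a : Fin (m + 1) → ℝ} (ha : a ≠ 0) (W : ℕ) :
    tauIntWindow (fun t => P[fun ω => blockFactor (maMap a) ξ 0 ω * blockFactor (maMap a) ξ t ω]
        / P[fun ω => blockFactor (maMap a) ξ 0 ω * blockFactor (maMap a) ξ 0 ω]) W
      = tauIntWindow (maRho a) W := by
  have hσ : maACF a 0 ≠ 0 := (maACF_zero_pos ha).ne'
  have h0 : maRho a 0 = 1 := div_self hσ
  simp only [integral_lagProd_maMap hξ hind hlaw ha, h0, mul_one]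
  congr 1
  funext t
  rw [mul_div_cancel_left₀ _ hσ]

/-- **THE `τ_int` CLT FOR GAUSSIAN MA DATA AT SCORER B's DATA-CHOSEN WINDOW — nothing left to assume
on the data.**  See the module docstring. -/
theorem gaussianMA_tauIntWindow_clt_at_msWindowSel (hξ : ∀ i, Measurable (ξ i)) (hind : iIndepFun ξ P)
    (hlaw : ∀ i, HasLaw (ξ i) (gaussianReal 0 1) P) {a : Fin (m + 1) → ℝ} (ha : a ≠ 0)
    {c : ℝ} (hc : 0 < c) {w Wmax : ℕ} (hwle : w ≤ Wmax)
    (hw : IsStrictMSWindow c (fun W => tauIntWindow (maRho a) W) w) :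
    TendstoInDistribution
      (fun (N : ℕ) ω =>
        Real.sqrt N * (tauIntWindow (fun t => acovHat (blockFactor (maMap a) ξ) N t ω
            / acovHat (blockFactor (maMap a) ξ) N 0 ω)
            (msWindowSel c Wmax (fun W => tauIntWindow (fun t =>
              acovHat (blockFactor (maMap a) ξ) N t ω / acovHat (blockFactor (maMap a) ξ) N 0 ω) W))
          - tauIntWindow (maRho a)
            (msWindowSel c Wmax (fun W => tauIntWindow (fun t =>
              acovHat (blockFactor (maMap a) ξ) N t ω / acovHat (blockFactor (maMap a) ξ) N 0 ω) W))))
      atTop (fun z : EuclideanSpace ℝ (Fin (w + 1)) =>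
        ⟪tauHatGrad w (toLp 2 fun t : Fin (w + 1) => maACF a 0 * maRho a t), z⟫) (fun _ => P)
      (multivariateGaussian 0 (Matrix.of fun s t : Fin (w + 1) =>
        lagProdACov (blockFactor (maMap a) ξ) P (m + w) s t))
    ∧ HasLaw (fun z : EuclideanSpace ℝ (Fin (w + 1)) =>
        ⟪tauHatGrad w (toLp 2 fun t : Fin (w + 1) => maACF a 0 * maRho a t), z⟫)
      (gaussianReal 0 (tauHatRatioAVar (maRho a) w).toNNReal)
      (multivariateGaussian 0 (Matrix.of fun s t : Fin (w + 1) =>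
        lagProdACov (blockFactor (maMap a) ξ) P (m + w) s t)) := by
  obtain ⟨hclt, hlaw'⟩ := gaussianMA_tauIntWindow_clt hξ hind hlaw ha w
  refine ⟨?_, hlaw'⟩
  have hid : ∀ i, IdentDistrib (ξ i) (ξ 0) P P := fun i =>
    ⟨(hξ i).aemeasurable, (hξ 0).aemeasurable, by rw [(hlaw i).map_eq, (hlaw 0).map_eq]⟩
  have hW := isWickFamily_maMap hξ hind hlaw a
  have hF := measurable_maMap a
  have h4 : ∀ t, MemLp (fun ω => blockFactor (maMap a) ξ 0 ω * blockFactor (maMap a) ξ t ω) 2 P :=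
    fun t => hW.memLp 0 t
  have hσ : P[fun ω => blockFactor (maMap a) ξ 0 ω * blockFactor (maMap a) ξ 0 ω] ≠ 0 := by
    rw [integral_lagProd_maMap hξ hind hlaw ha 0, maRho, div_self (maACF_zero_pos ha).ne', mul_one]
    exact (maACF_zero_pos ha).ne'
  set τhat : ℕ → ℕ → Ω → ℝ := fun N W ω => tauIntWindow (fun t => acovHat (blockFactor (maMap a) ξ) N t ω
      / acovHat (blockFactor (maMap a) ξ) N 0 ω) W with hτhat
  have hτm : ∀ N W, Measurable (τhat N W) := fun N W => measurable_tauIntWindow_acovHat hξ hF N W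
  have hWm : ∀ N, Measurable fun ω => msWindowSel c Wmax (fun W => τhat N W ω) :=
    fun N => measurable_msWindowSel (fun W => hτm N W) c Wmax
  have hconv : ∀ W, 1 ≤ W → W ≤ w →
      TendstoInMeasure P (fun N => τhat N W) atTop fun _ => tauIntWindow (maRho a) W := by
    intro W _ _
    have h := tendstoInMeasure_tauIntWindow_blockFactor hξ hind hid hF h4 hσ W
    rw [popCurve_maMap hξ hind hlaw ha W] at h
    exact h
  have hsel : ∀ N ω, IsMSWindow c (fun W => τhat N W ω) w →
      msWindowSel c Wmax (fun W => τhat N W ω) = w :=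
    fun _ _ h => msWindowSel_eq_of_isMSWindow h hwle
  exact tendstoInDistribution_tauHat_at_msWindow (τW := fun W => tauIntWindow (maRho a) W)
    hclt hτm hWm hc hw hconv hsel

end GaussianMA

end Summit.Ventures.LatticeQCDFlow.Scoring

end
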